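import Literature.RepresentationTheory.NormalSubalgebraClifford
import Literature.LinearAlgebra.Matrix.MatrixAlgHomConj
import Mathlib.RingTheory.SimpleModule.WedderburnArtin
import Mathlib.RingTheory.SimpleRing.Field
import Mathlib.RingTheory.SimpleRing.Matrix
import Mathlib.RingTheory.SimpleRing.Congr
import Mathlib.RingTheory.LittleWedderburn
import Mathlib.FieldTheory.Fixed
import Mathlib.LinearAlgebra.Matrix.ToLin
import Mathlib.LinearAlgebra.Matrix.GeneralLinearGroup.Card
import HarnessLib

/-!
# A numerical criterion for very simplicity (Dolgachev–Zarhin, proof of Theorem 2.21, Steps 3–4)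

Topic `Literature/RepresentationTheory`, namespace `Literature.RepresentationTheory`; lane `lit-hodgefound`
(Track 2 foundations library), row g9-#1 «(g8-#1)⁺ · (g8-#2)⁺ — DZ24 §2.3 Theorem 2.21 for `ℓ ∈ {2, 3}`» of
seat p11 (gen 9), FILE 1 of 2 — the GROUP-INDEPENDENT part of the printed proof (Steps 3–4 and the order
count of Case (ii)); FILE 2 (`Literature/RepresentationTheory/AugmentationModuleVerySimple.lean`) supplies
the `𝔄_n`-module `(𝔽_ℓ^ℜ)^0`. Sequel of `VerySimpleRepresentations.lean` (Zarhin's `IsNormalSubalgebra`,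
`IsVerySimple`; g8-#1) and `NormalSubalgebraClifford.lean` (Steps 1–2; g8-#2). Plumbing definitions with
bodies (the conjugation actions `conjEnd`/`conjEndAlgEquiv`/`conjEndHom`, `conjSub`/`conjSubAlgEquiv`/
`conjSubHom`, the centre transport `centerCongr`/`centerCongrHom`, inner automorphisms `innerAlgEquiv`,
and the structure isomorphisms `endAlgEquivMatrix`, `endAlgEquivMatrixField`, `toEndScalar`,
`algEquivMatrixField`); everything else is a THEOREM. No named fact (net debt 0).

## Source READ (held text), verbatim

I. Dolgachev, Yu. G. Zarhin, *Endomorphisms of Complex Abelian Varieties* (notes dated 31 July 2024; bib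
`DolgachevZarhin2024`; held text `paper:galaxy-pdf-8712177384607648460`), §2.3 "Permutational
representations". p0039 L7: "**Theorem 2.21.** Suppose that `n ≥ 5` and `G = 𝔖_n` or `𝔄_n`. Then, the
`G`-module `(𝔽_ℓ^ℜ)^0` is very simple for all prime `ℓ` except the case where `n = 5` and `ℓ ≡ ±1 mod 5`."
Proof, p0039 L13–L15: "Using Remark 2.22, it suffices to check the case `G = 𝔄_n = Alt(ℜ)`. We have already
seen that the faithful `G = Alt(ℜ)`-module `𝒱 = (𝔽_ℓ^ℜ)^0` is absolutely simple. Let `R ⊂ End_{𝔽_ℓ}(𝒱)` be a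
`G`-normal subalgebra. Clearly, `𝒱` is a faithful `R`-module." Steps 1–2 (p0039 L17–p0040 L1; FILE
`NormalSubalgebraClifford`): `𝒱` is a semisimple, indeed isotypic, `R`-module. **Step 3** (p0040 L3–p0041
L9): "Since `𝒱` is isotypic, there exist a simple `R`-module `W` and a positive integer `d` such that the
`R`-modules `𝒱` and `W^d` are isomorphic. It follows that `d · dim(W) = dim(𝒱) = n − 1` and the centralizer
`End_R(𝒱)` is isomorphic to the matrix algebra `Mat_d(End_R(W))` of size `d` over `End_R(W)`. Let us put
`F = End_R(W)`. Since `W` is simple, `F` is a finite division algebra of characteristic `ℓ`. Therefore `F`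
is a finite field of characteristic `ℓ` […]. We have `End_R(𝒱) ≅ Mat_d(F)`. Clearly,
`End_R(𝒱) ⊂ End_{𝔽_ℓ}(𝒱)` is stable under the adjoint action of `𝔄_n`. This induces a group homomorphism
`α : 𝔄_n → Aut(End_R(𝒱)) = Aut(Mat_d(F))`. Since `F` is the center of `Mat_d(F)`, it is stable under the
action of `𝔄_n`, i.e., we get a homomorphism `𝔄_n → Aut(F)`, which must be trivial, since `𝔄_n` is a simple
non-abelian group, and `Aut(F) = Gal(F/𝔽_ℓ)` is abelian. This implies that the center `F` of `End_R(𝒱)`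
commutes with `𝔄_n`. Since `End_G(𝒱) = 𝔽_ℓ` (recall that the `𝔄_n`-module `𝒱` is absolutely simple), we
have `k = 𝔽_ℓ`. This implies that `End_R(𝒱) ≅ Mat_d(𝔽_ℓ)`, and
`α : 𝔄_n → Aut(End_R(𝒱)) = (End_R(𝒱))^*/𝔽_ℓ^* ≅ GL(d, 𝔽_ℓ)/𝔽_ℓ^* = PGL(d, 𝔽_ℓ)` is trivial if and only
if `End_R(𝒱) ⊂ End_{𝔄_n}(V) = 𝔽_ℓ·Id`. Since `End_R(𝒱) ≅ Mat_d(𝔽_ℓ)`, `α` is trivial if and only if `d = 1`,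
i.e. `𝒱` is an absolutely simple `R`-module. It follows from the Jacobson density theorem (see [18, §5] or
[101, Chapter 4, §11]) that `R ≅ Mat_m(𝔽_ℓ)` with `dm = n − 1`. This implies that `α` is trivial if and only
if `R ≅ Mat_{n−1}(𝔽_ℓ)`, i.e., `R = End(𝒱)`. The adjoint action of `𝔄_n` on `R` gives rise to a homomorphism
`β : 𝔄_n → Aut(R) = R^*/𝔽_ℓ^* ≅ PGL(m, 𝔽_ℓ)`. Clearly, `β` is trivial if and only if `R` commutes with
`𝔄_n`, i.e., `R = 𝔽_ℓ·Id`. This implies that we are done if either `α`, or `β` is trivial." **Step 4**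
(p0041 L11–L31): "Recall that `md = n − 1`. Let us put `c := min(d, m)`. Then `c² ≤ n − 1` and either
`c = d`, or `c = m`. Thus, it suffices to check that every group homomorphism `𝔄_n → PGL(c, 𝔽_ℓ)` is
trivial. […] (ii) Suppose that `ℓ^{n−1}/(ℓ−1) < n!/2`. Since `c² ≤ n−1`, the order of `PGL(c, 𝔽_ℓ)` is
strictly less than the ratio `ℓ^{c²}/(ℓ−1) ≤ ℓ^{n−1}/(ℓ−1) < n!/2`. Since the order of `𝔄_n` is `n!/2`, every
homomorphism from `𝔄_n` to `PGL(c, 𝔽_ℓ)` is trivial, so we are done." The Jacobson density theorem invoked is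
Mathlib's `jacobson_density` / `Module.Finite.toModuleEnd_moduleEnd_surjective` ([18, §5] = N. Bourbaki,
*Algèbre* VIII §5; [101] = T. Y. Lam, GTM 131, Ch. 4 §11), used below, not restated.

## What is here — Steps 3–4 for EVERY group `G` over a finite field `k`

Throughout `ρ : Representation k G V`, `R : Subalgebra k (Module.End k V)` with `h : IsNormalSubalgebra ρ R`
(Def. 2.1), `V` viewed as an `R`-module through `R ⊂ End_k(V)` (as in `NormalSubalgebraClifford`); the
structure lemmas of §3 are stated for an arbitrary `k`-algebra `A` acting on `V` (they are applied with
`A = R`).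

* §1 "the adjoint action": `h.conjEnd s : f ↦ ρ(s) f ρ(s)⁻¹` on the commutant `End_R(V)` (it IS again
  `R`-linear because `ρ(s)⁻¹ R ρ(s) = R`), as `k`-algebra automorphisms `h.conjEndAlgEquiv s` and the
  homomorphism **`h.conjEndHom : G →* (End_R(V) ≃ₐ[k] End_R(V))`** ("`α`"); the action on `R` itself,
  `h.conjSub s : r ↦ ρ(s) r ρ(s)⁻¹`, **`h.conjSubHom : G →* (R ≃ₐ[k] R)`** ("`β`"). With the hypothesis
  "`End_G(𝒱) = k`" spelled `Subalgebra.centralizer k (Set.range ρ) = ⊥`: "`β` trivial ⇒ `R = k·Id`"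
  (`eq_bot_of_conjSubHom_eq_one`) and "an element of `End_R(𝒱)` fixed by `α` is a scalar"
  (`exists_eq_smul_one_of_forall_conjEnd_eq`).
* §2 "It follows from the Jacobson density theorem": for `V` semisimple over `R`, if every `R`-endomorphism
  of `V` is a scalar then `R = End_k(V)` (`eq_top_of_forall_end_exists_smul`, Burnside's form; Mathlib's
  double-centraliser `Module.Finite.toModuleEnd_moduleEnd_surjective`); hence "`α` trivial ⇒ `R = End(𝒱)`"
  (`eq_top_of_conjEndHom_eq_one`).
* §3 the structure of Step 3 from an `R`-isomorphism `e : V ≅ W^d` (`W` simple): `End_A(V) ≃ₐ[k]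
  Mat_d(End_A(W))` (`endAlgEquivMatrix`, Mathlib `LinearEquiv.conjAlgEquiv` + `endVecAlgEquivMatrixEnd`),
  so `End_A(V)` is a simple ring (`isSimpleRing_end`); "`F = End_R(W)` is a finite division algebra …
  Therefore `F` is a finite field" (`finite_end`, `end_mul_comm`, Wedderburn's little theorem
  `Finite.isDomain_to_isField`); the scalar `diag(f, …, f)` is central (`symm_scalar_mem_center`), so a
  trivial centre forces "`k = 𝔽_ℓ`", i.e. `F = k` (`exists_end_eq_smul_of_center_eq_bot`);
  `d · dim W = dim 𝒱` (`finrank_eq_mul`); "`End_R(𝒱) ≅ Mat_d(𝔽_ℓ)`" (`endAlgEquivMatrixField`);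
  "`R ≅ Mat_m(𝔽_ℓ)` with `dm = n − 1`" by density on `W` (`toEndScalar`, `toEndScalar_injective`,
  `toEndScalar_surjective`, `algEquivMatrixField`, `m = dim_k W`).
* §4 the centre step: the centre `Z` of the simple ring `End_R(𝒱)` is a field (`isField_center_of_isSimpleRing`,
  Mathlib `IsSimpleRing.isField_center`) of `k`-dimension `≤ dim 𝒱` (`finrank_center_end_le`: `z ↦ z(v₀)`
  is injective), it is stable under `α` (`centerCongr`, `centerCongrHom`), and **if `dim_k 𝒱 < |G|` for a
  finite simple `G` then `Z = k`** (`center_end_eq_bot`). DEVIATION (shorter road, recorded): the print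
  kills `G → Aut(F)` by "`𝔄_n` perfect, `Aut(F) = Gal(F/𝔽_ℓ)` abelian"; here it is killed by the SAME order
  count the print uses in Step 4 (ii) — `#Aut_k(Z) ≤ [Z : k] ≤ dim_k 𝒱 < |G|` (Dedekind's bound
  `AlgEquiv.card_le`) and a homomorphism from a simple group to a smaller finite group is trivial
  (`monoidHom_eq_one_of_card_lt`). The two arguments need different inputs (perfectness vs. `dim 𝒱 < |G|`);
  for `𝔄_n` on `(𝔽_ℓ^ℜ)^0` both hold (`n − 1 < n!/2`).
* §5 Step 4 with the count of Case (ii): inner automorphisms `innerAlgEquiv u : x ↦ u x u⁻¹`; by the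
  Skolem–Noether theorem for matrix algebras (the tree's `Literature.LinearAlgebra.Matrix.exists_algHom_apply_eq_conj`)
  every `k`-algebra automorphism of `Mat_c(k)` is inner, so **`#Aut_{k-alg}(Mat_c(k)) ≤ #GL_c(k)`**
  (`natCard_algEquiv_matrix_le`). DEVIATION (recorded): the print bounds `#PGL(c, 𝔽_ℓ) < ℓ^{c²}/(ℓ−1)`; we
  keep the cruder `#GL_c(k)` (`= ∏_{i<c} (q^c − q^i)`, Mathlib `Matrix.card_GL_field`) as the stated bound
  and leave the numerics to the user (FILE 2 checks `#GL_c(𝔽_ℓ) < n!/2` for `ℓ ∈ {2,3}`, `c² ≤ n − 1`).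
  "every homomorphism `G → 𝐒_r`, `r ≤ dim 𝒱`, is trivial" from `(dim 𝒱)! < |G|`
  (`perm_hom_eq_one_of_factorial_lt`).
* §6 **the criterion** (`isVerySimple_of_card_lt`): `k` a finite field, `V` a finite-dimensional
  irreducible `G`-module with `End_G(V) = k`, `G` a finite simple group with `(dim_k V)! < |G|` and
  `#GL_c(k) < |G|` whenever `c² ≤ dim_k V`. Then `V` is very simple. Proof = the print: `R` normal ⇒ (Steps
  1–2) `V ≅ W^d` isotypic ⇒ (§4) `F = k` ⇒ `End_R(V) ≅ Mat_d(k)`, `R ≅ Mat_m(k)`, `dm = dim V`; with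
  `c = min(d, m)`, `c² ≤ dm`, the action `α` (if `d ≤ m`) or `β` (if `m ≤ d`) lands in a group of order
  `≤ #GL_c(k) < |G|`, hence is trivial, hence `R = End(V)` or `R = k·Id`.

## References

* [DolgachevZarhin2024] I. Dolgachev, Yu. G. Zarhin, *Endomorphisms of Complex Abelian Varieties* (2024),
  §2.3 Theorem 2.21, proof, Steps 3–4 and Case (ii) (held text p0039 L7–L15, p0040 L3–p0041 L31).
* [Zarhin2002VerySimple] Yu. G. Zarhin, *Very simple 2-adic representations and hyperelliptic Jacobians*,
  Mosc. Math. J. 2 (2002) 403–431, §4 Def. 4.1 (very simple modules).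
* [BourbakiAlgebreVIII2012] N. Bourbaki, *Algèbre*, Ch. VIII (2012), §5 (density theorem) = DZ24's [18].
-/

namespace Literature.RepresentationTheory

open Module

/-! ## §1 The adjoint actions of `G` on `End_R(V)` ("`α`") and on `R` ("`β`") -/

namespace IsNormalSubalgebra

section CommRing

variable {k : Type*} [CommRing k] {G : Type*} [Group G] {V : Type*} [AddCommGroup V] [Module k V]
variable {ρ : Representation k G V} {R : Subalgebra k (Module.End k V)}

/-- **"`End_R(𝒱) ⊂ End_{𝔽_ℓ}(𝒱)` is stable under the adjoint action"**: for a `G`-normal `R` and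
`s ∈ G`, conjugation `f ↦ ρ(s) f ρ(s)⁻¹` maps the commutant `End_R(V)` to itself — `ρ(s)⁻¹ r = r' ρ(s)⁻¹`
and `ρ(s) r' = r ρ(s)` with `r' = ρ(s)⁻¹ r ρ(s) ∈ R`. [cite: DolgachevZarhin2024, §2.3 proof of Theorem 2.21, Step 3] -/
def conjEnd (h : IsNormalSubalgebra ρ R) (s : G) (f : Module.End R V) : Module.End R V where
  toFun v := ρ s (f (ρ s⁻¹ v))
  map_add' v w := by simp only [map_add]
  map_smul' r v := by
    have hr : ρ s⁻¹ * (r : Module.End k V) * ρ s⁻¹⁻¹ ∈ R := h.conj_mem s⁻¹ r.2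
    have h1 : ρ s⁻¹ ((r : Module.End k V) v) = (⟨_, hr⟩ : R) • ρ s⁻¹ v := by
      change _ = (ρ s⁻¹ * (r : Module.End k V) * ρ s⁻¹⁻¹) (ρ s⁻¹ v)
      rw [inv_inv, Module.End.mul_apply, Module.End.mul_apply, Representation.self_inv_apply]
    have h2 : ∀ w : V, ρ s (((⟨_, hr⟩ : R) : Module.End k V) w) = (r : Module.End k V) (ρ s w) := by
      intro w
      change ρ s ((ρ s⁻¹ * (r : Module.End k V) * ρ s⁻¹⁻¹) w) = _
      rw [inv_inv, Module.End.mul_apply, Module.End.mul_apply, Representation.self_inv_apply]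
    change ρ s (f (ρ s⁻¹ ((r : Module.End k V) v))) = (r : Module.End k V) (ρ s (f (ρ s⁻¹ v)))
    rw [h1, map_smul]
    exact h2 _

/-- Unfolding: `(conjEnd s f) v = ρ(s) (f (ρ(s⁻¹) v))`. [cite: DolgachevZarhin2024, §2.3 proof of Theorem 2.21, Step 3] -/
@[simp] theorem conjEnd_apply (h : IsNormalSubalgebra ρ R) (s : G) (f : Module.End R V) (v : V) :
    h.conjEnd s f v = ρ s (f (ρ s⁻¹ v)) := rfl

/-- `conjEnd 1 = id`. [cite: DolgachevZarhin2024, §2.3 proof of Theorem 2.21, Step 3] -/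
theorem conjEnd_one (h : IsNormalSubalgebra ρ R) (f : Module.End R V) : h.conjEnd 1 f = f := by
  ext v; simp

/-- `conjEnd (st) = conjEnd s ∘ conjEnd t`. [cite: DolgachevZarhin2024, §2.3 proof of Theorem 2.21, Step 3] -/
theorem conjEnd_mul (h : IsNormalSubalgebra ρ R) (s t : G) (f : Module.End R V) :
    h.conjEnd (s * t) f = h.conjEnd s (h.conjEnd t f) := by
  ext v; simp [mul_inv_rev]

/-- The adjoint action of `s` on `End_R(V)` as a `k`-algebra automorphism (inverse: the action of `s⁻¹`).
[cite: DolgachevZarhin2024, §2.3 proof of Theorem 2.21, Step 3] -/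
def conjEndAlgEquiv (h : IsNormalSubalgebra ρ R) (s : G) : Module.End R V ≃ₐ[k] Module.End R V where
  toFun := h.conjEnd s
  invFun := h.conjEnd s⁻¹
  left_inv f := by rw [← conjEnd_mul, inv_mul_cancel, conjEnd_one]
  right_inv f := by rw [← conjEnd_mul, mul_inv_cancel, conjEnd_one]
  map_mul' f g := by ext v; simp
  map_add' f g := by ext v; simp
  commutes' c := by
    ext v
    simp [Algebra.algebraMap_eq_smul_one]

/-- Unfolding of `conjEndAlgEquiv`. [cite: DolgachevZarhin2024, §2.3 proof of Theorem 2.21, Step 3] -/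
@[simp] theorem conjEndAlgEquiv_apply (h : IsNormalSubalgebra ρ R) (s : G) (f : Module.End R V) :
    h.conjEndAlgEquiv s f = h.conjEnd s f := rfl

/-- **"`α : G → Aut(End_R(𝒱))`"**, the adjoint action of `G` on the commutant of a normal `R` by
`k`-algebra automorphisms. [cite: DolgachevZarhin2024, §2.3 proof of Theorem 2.21, Step 3] -/
def conjEndHom (h : IsNormalSubalgebra ρ R) : G →* (Module.End R V ≃ₐ[k] Module.End R V) where
  toFun := h.conjEndAlgEquiv
  map_one' := AlgEquiv.ext fun f ↦ h.conjEnd_one f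
  map_mul' s t := AlgEquiv.ext fun f ↦ h.conjEnd_mul s t f

/-- Unfolding of `conjEndHom`. [cite: DolgachevZarhin2024, §2.3 proof of Theorem 2.21, Step 3] -/
@[simp] theorem conjEndHom_apply (h : IsNormalSubalgebra ρ R) (s : G) (f : Module.End R V) :
    h.conjEndHom s f = h.conjEnd s f := rfl

/-- **"The adjoint action of `𝔄_n` on `R`"**: `r ↦ ρ(s) r ρ(s)⁻¹` as a map `R → R` (Definition 2.1).
[cite: DolgachevZarhin2024, §2.3 proof of Theorem 2.21, Step 3] -/
def conjSub (h : IsNormalSubalgebra ρ R) (s : G) (r : R) : R :=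
  ⟨ρ s * (r : Module.End k V) * ρ s⁻¹, h.conj_mem s r.2⟩

/-- Unfolding of `conjSub`. [cite: DolgachevZarhin2024, §2.3 proof of Theorem 2.21, Step 3] -/
@[simp] theorem coe_conjSub (h : IsNormalSubalgebra ρ R) (s : G) (r : R) :
    ((h.conjSub s r : R) : Module.End k V) = ρ s * (r : Module.End k V) * ρ s⁻¹ := rfl

/-- The adjoint action of `s` on `R` as a `k`-algebra automorphism of `R`.
[cite: DolgachevZarhin2024, §2.3 proof of Theorem 2.21, Step 3] -/
def conjSubAlgEquiv (h : IsNormalSubalgebra ρ R) (s : G) : R ≃ₐ[k] R where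
  toFun := h.conjSub s
  invFun := h.conjSub s⁻¹
  left_inv r := by
    apply Subtype.ext
    simp only [coe_conjSub, inv_inv]
    rw [← mul_assoc, ← mul_assoc, ← map_mul, inv_mul_cancel, map_one, one_mul, mul_assoc, ← map_mul,
      inv_mul_cancel, map_one, mul_one]
  right_inv r := by
    apply Subtype.ext
    simp only [coe_conjSub, inv_inv]
    rw [← mul_assoc, ← mul_assoc, ← map_mul, mul_inv_cancel, map_one, one_mul, mul_assoc, ← map_mul,
      mul_inv_cancel, map_one, mul_one]
  map_mul' r r' := by
    apply Subtype.ext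
    simp only [coe_conjSub, Subalgebra.coe_mul]
    rw [mul_assoc (ρ s * ↑r) (ρ s⁻¹), ← mul_assoc (ρ s⁻¹) (ρ s * ↑r'), ← mul_assoc (ρ s⁻¹) (ρ s),
      ← map_mul, inv_mul_cancel, map_one, one_mul, ← mul_assoc, ← mul_assoc]
  map_add' r r' := by
    apply Subtype.ext
    simp only [coe_conjSub, Subalgebra.coe_add, mul_add, add_mul]
  commutes' c := by
    apply Subtype.ext
    simp only [coe_conjSub, Subalgebra.coe_algebraMap]
    rw [← Algebra.commutes, mul_assoc, ← map_mul, mul_inv_cancel, map_one, mul_one]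

/-- Unfolding of `conjSubAlgEquiv`. [cite: DolgachevZarhin2024, §2.3 proof of Theorem 2.21, Step 3] -/
@[simp] theorem conjSubAlgEquiv_apply (h : IsNormalSubalgebra ρ R) (s : G) (r : R) :
    h.conjSubAlgEquiv s r = h.conjSub s r := rfl

/-- **"`β : G → Aut(R)`"**, the adjoint action of `G` on a normal `R` by `k`-algebra automorphisms.
[cite: DolgachevZarhin2024, §2.3 proof of Theorem 2.21, Step 3] -/
def conjSubHom (h : IsNormalSubalgebra ρ R) : G →* (R ≃ₐ[k] R) where
  toFun := h.conjSubAlgEquiv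
  map_one' := AlgEquiv.ext fun r ↦ Subtype.ext <| by
    change ((h.conjSub 1 r : R) : Module.End k V) = r
    simp
  map_mul' s t := AlgEquiv.ext fun r ↦ Subtype.ext <| by
    change ((h.conjSub (s * t) r : R) : Module.End k V) = h.conjSub s (h.conjSub t r)
    simp only [coe_conjSub, map_mul, mul_inv_rev, mul_assoc]

/-- Unfolding of `conjSubHom`. [cite: DolgachevZarhin2024, §2.3 proof of Theorem 2.21, Step 3] -/
@[simp] theorem conjSubHom_apply (h : IsNormalSubalgebra ρ R) (s : G) (r : R) :
    h.conjSubHom s r = h.conjSub s r := rfl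

end CommRing

section Field

variable {k : Type*} [Field k] {G : Type*} [Group G] {V : Type*} [AddCommGroup V] [Module k V]
variable {ρ : Representation k G V} {R : Subalgebra k (Module.End k V)}

/-- **"`β` is trivial if and only if `R` commutes with `𝔄_n`, i.e., `R = 𝔽_ℓ·Id`"** (the direction used):
with `End_G(V) = k·Id` (`Subalgebra.centralizer k (ρ(G)) = ⊥`), if every `r ∈ R` is fixed by all
`ρ(s) · ρ(s)⁻¹` then `R = k·Id`. [cite: DolgachevZarhin2024, §2.3 proof of Theorem 2.21, Step 3] -/
theorem eq_bot_of_forall_conjSub_eq (h : IsNormalSubalgebra ρ R)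
    (hcomm : Subalgebra.centralizer k (Set.range (ρ : G → Module.End k V)) = ⊥)
    (hfix : ∀ (s : G) (r : R), h.conjSub s r = r) : R = ⊥ := by
  refine le_antisymm (fun r hr ↦ ?_) bot_le
  rw [← hcomm, Subalgebra.mem_centralizer_iff]
  rintro _ ⟨s, rfl⟩
  have h1 := congrArg Subtype.val (hfix s ⟨r, hr⟩)
  simp only [coe_conjSub] at h1
  -- `ρ s * r * ρ s⁻¹ = r` ⇒ `ρ s * r = r * ρ s`
  have h2 := congrArg (· * ρ s) h1
  simp only [mul_assoc, ← map_mul, inv_mul_cancel, map_one, mul_one] at h2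
  exact h2

/-- "`β` trivial ⇒ `R = 𝔽_ℓ·Id`" for the homomorphism `conjSubHom`.
[cite: DolgachevZarhin2024, §2.3 proof of Theorem 2.21, Step 3] -/
theorem eq_bot_of_conjSubHom_eq_one (h : IsNormalSubalgebra ρ R)
    (hcomm : Subalgebra.centralizer k (Set.range (ρ : G → Module.End k V)) = ⊥)
    (h1 : h.conjSubHom = 1) : R = ⊥ :=
  h.eq_bot_of_forall_conjSub_eq hcomm fun s r ↦ by
    have := AlgEquiv.congr_fun (DFunLike.congr_fun h1 s) r
    simpa using this

/-- **An element of `End_R(𝒱)` fixed by the adjoint action is a scalar** (with `End_G(V) = k·Id`): if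
`ρ(s) f ρ(s)⁻¹ = f` for all `s` then `f` commutes with `ρ(G)`, so `f = c·Id`.
[cite: DolgachevZarhin2024, §2.3 proof of Theorem 2.21, Step 3] -/
theorem exists_eq_smul_one_of_forall_conjEnd_eq (h : IsNormalSubalgebra ρ R)
    (hcomm : Subalgebra.centralizer k (Set.range (ρ : G → Module.End k V)) = ⊥)
    {f : Module.End R V} (hfix : ∀ s : G, h.conjEnd s f = f) :
    ∃ c : k, f = c • (1 : Module.End R V) := by
  have hmem : f.restrictScalars k ∈ Subalgebra.centralizer k (Set.range (ρ : G → Module.End k V)) := by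
    rw [Subalgebra.mem_centralizer_iff]
    rintro _ ⟨s, rfl⟩
    ext v
    have := congrArg (fun g : Module.End R V ↦ g (ρ s v)) (hfix s)
    simp only [conjEnd_apply, Representation.inv_self_apply] at this
    simpa using this
  rw [hcomm, Algebra.mem_bot] at hmem
  obtain ⟨c, hc⟩ := hmem
  refine ⟨c, LinearMap.ext fun v ↦ ?_⟩
  have := congrArg (fun g : Module.End k V ↦ g v) hc
  simp only [Algebra.algebraMap_eq_smul_one, LinearMap.smul_apply, Module.End.one_apply,
    LinearMap.coe_restrictScalars] at this
  simpa using this.symm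

/-! ## §2 "It follows from the Jacobson density theorem": Burnside's form -/

/-- **Burnside / density**: if `V` is a semisimple `R`-module (`R ⊂ End_k(V)` a subalgebra, `V`
finite-dimensional) and every `R`-endomorphism of `V` is a scalar, then `R = End_k(V)` — every `k`-linear
map commutes with `End_R(V) = k`, hence (Mathlib's double-centraliser form of the density theorem,
`Module.Finite.toModuleEnd_moduleEnd_surjective`) is the action of some `r ∈ R`.
[cite: DolgachevZarhin2024, §2.3 proof of Theorem 2.21, Step 3] [cite: BourbakiAlgebreVIII2012, §5] -/
theorem eq_top_of_forall_end_exists_smul [FiniteDimensional k V] [IsSemisimpleModule R V]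
    (hE : ∀ f : Module.End R V, ∃ c : k, f = c • (1 : Module.End R V)) : R = ⊤ := by
  haveI : Module.Finite (Module.End R V) V := Module.Finite.of_restrictScalars_finite k (Module.End R V) V
  refine eq_top_iff.2 fun g _ ↦ ?_
  -- `g` commutes with `End_R(V) = k`, so it is `End_R(V)`-linear
  let g' : Module.End (Module.End R V) V :=
    { toFun := g
      map_add' := map_add g
      map_smul' := fun f v ↦ by
        obtain ⟨c, rfl⟩ := hE f
        change g ((c • (1 : Module.End R V)) v) = (c • (1 : Module.End R V)) (g v)
        simp }
  obtain ⟨r, hr⟩ := Module.Finite.toModuleEnd_moduleEnd_surjective (R := R) (M := V) g'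
  have hrg : (r : Module.End k V) = g := by
    ext v
    have := congrArg (fun φ : Module.End (Module.End R V) V ↦ φ v) hr
    simp only [Module.toModuleEnd_apply, g', LinearMap.coe_mk, AddHom.coe_mk] at this
    exact this
  exact hrg ▸ r.2

/-- **"`α` is trivial if and only if … `R = End(𝒱)`"** (the direction used): for `V` semisimple over the
normal `R` and `End_G(V) = k·Id`, if the adjoint action on `End_R(V)` is trivial then `R = End_k(V)`.
[cite: DolgachevZarhin2024, §2.3 proof of Theorem 2.21, Step 3] -/
theorem eq_top_of_conjEndHom_eq_one [FiniteDimensional k V] [IsSemisimpleModule R V]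
    (h : IsNormalSubalgebra ρ R)
    (hcomm : Subalgebra.centralizer k (Set.range (ρ : G → Module.End k V)) = ⊥)
    (h1 : h.conjEndHom = 1) : R = ⊤ :=
  eq_top_of_forall_end_exists_smul fun f ↦
    h.exists_eq_smul_one_of_forall_conjEnd_eq hcomm fun s ↦ by
      have := AlgEquiv.congr_fun (DFunLike.congr_fun h1 s) f
      simpa using this

end Field

end IsNormalSubalgebra

/-! ## §3 Step 3: the structure of `End_R(V)` and of `R` from `V ≅ W^d` -/

section Structure

variable {k : Type*} [Field k] {A : Type*} [Ring A] [Algebra k A]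
  {V : Type*} [AddCommGroup V] [Module k V] [Module A V] [IsScalarTower k A V]
  {W : Type*} [AddCommGroup W] [Module k W] [Module A W] [IsScalarTower k A W]
  {d : ℕ}

/-- **"`End_R(𝒱)` is isomorphic to the matrix algebra `Mat_d(End_R(W))`"**, from an isomorphism
`e : V ≅ W^d` of `A`-modules (Mathlib: conjugation by `e`, then `End_A(W^d) = Mat_d(End_A(W))`).
[cite: DolgachevZarhin2024, §2.3 proof of Theorem 2.21, Step 3] -/
noncomputable def endAlgEquivMatrix (e : V ≃ₗ[A] (Fin d → W)) :
    Module.End A V ≃ₐ[k] Matrix (Fin d) (Fin d) (Module.End A W) :=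
  (e.conjAlgEquiv k).trans (endVecAlgEquivMatrixEnd (Fin d) k A W)

include k in
open Classical in
/-- `End_A(V) ≅ Mat_d(End_A(W))` with `W` simple (`End_A(W)` a division ring, Schur) is a simple ring.
[cite: DolgachevZarhin2024, §2.3 proof of Theorem 2.21, Step 3] -/
theorem isSimpleRing_end [IsSimpleModule A W] [NeZero d] (e : V ≃ₗ[A] (Fin d → W)) :
    IsSimpleRing (Module.End A V) := by
  haveI : Nonempty (Fin d) := ⟨⟨0, Nat.pos_of_ne_zero (NeZero.ne d)⟩⟩
  exact IsSimpleRing.of_ringEquiv (endAlgEquivMatrix (k := k) e).symm.toRingEquiv inferInstance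

/-- **"`F` is a finite division algebra"**: over a finite field `k`, `End_A(W)` (`W` finite-dimensional)
is finite — it embeds in `End_k(W)`. [cite: DolgachevZarhin2024, §2.3 proof of Theorem 2.21, Step 3] -/
theorem finite_end [Finite k] [Module.Finite k W] : Finite (Module.End A W) := by
  haveI : Module.Finite k (W →ₗ[k] W) := Module.Finite.linearMap k k W W
  haveI : Finite (W →ₗ[k] W) := Module.finite_of_finite k
  exact Finite.of_injective (fun f : Module.End A W ↦ f.restrictScalars k)
    (LinearMap.restrictScalars_injective k)

open Classical in
/-- **"Therefore `F` is a finite field"** — the part used: `End_A(W)` is commutative (`W` simple, `k`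
finite; Wedderburn's little theorem, Mathlib `Finite.isDomain_to_isField`).
[cite: DolgachevZarhin2024, §2.3 proof of Theorem 2.21, Step 3] -/
theorem end_mul_comm [Finite k] [Module.Finite k W] [IsSimpleModule A W] (a b : Module.End A W) :
    a * b = b * a := by
  haveI := finite_end (k := k) (A := A) (W := W)
  exact (Finite.isDomain_to_isField (Module.End A W)).mul_comm a b

/-- **"`F` is the center of `Mat_d(F)`"** (the inclusion used): for `f ∈ End_A(W)` commuting with all of
`End_A(W)`, the diagonal endomorphism `e⁻¹ ∘ diag(f, …, f) ∘ e` is central in `End_A(V)`.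
[cite: DolgachevZarhin2024, §2.3 proof of Theorem 2.21, Step 3] -/
theorem symm_scalar_mem_center (e : V ≃ₗ[A] (Fin d → W)) {f : Module.End A W}
    (hf : ∀ g : Module.End A W, f * g = g * f) :
    (endAlgEquivMatrix (k := k) e).symm (Matrix.scalar (Fin d) f) ∈
      Subalgebra.center k (Module.End A V) := by
  rw [Subalgebra.mem_center_iff]
  intro b
  obtain ⟨M, rfl⟩ := (endAlgEquivMatrix (k := k) e).symm.surjective b
  rw [← map_mul, ← map_mul, (Matrix.scalar_commute f (fun g ↦ (hf g)) M).eq]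

/-- **"This implies that the center `F` of `End_R(𝒱)` commutes with `𝔄_n` … we have `k = 𝔽_ℓ`"** (the
conclusion `F = k`): if `End_A(W)` is commutative and the centre of `End_A(V)` (`V ≅ W^d`, `d ≥ 1`) is
reduced to the scalars, then every `A`-endomorphism of `W` is a scalar.
[cite: DolgachevZarhin2024, §2.3 proof of Theorem 2.21, Step 3] -/
theorem exists_end_eq_smul_of_center_eq_bot [NeZero d] (e : V ≃ₗ[A] (Fin d → W))
    (hcomm : ∀ a b : Module.End A W, a * b = b * a)
    (hZ : Subalgebra.center k (Module.End A V) = ⊥) (f : Module.End A W) :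
    ∃ c : k, f = c • (1 : Module.End A W) := by
  have hmem := symm_scalar_mem_center (k := k) e (f := f) (fun g ↦ hcomm f g)
  rw [hZ, Algebra.mem_bot] at hmem
  obtain ⟨c, hc⟩ := hmem
  refine ⟨c, ?_⟩
  have h1 : Matrix.scalar (Fin d) f = algebraMap k (Matrix (Fin d) (Fin d) (Module.End A W)) c := by
    rw [← (endAlgEquivMatrix (k := k) e).symm.injective.eq_iff, AlgEquiv.commutes, hc]
  have h2 := congrFun (congrFun h1 ⟨0, Nat.pos_of_ne_zero (NeZero.ne d)⟩)
    ⟨0, Nat.pos_of_ne_zero (NeZero.ne d)⟩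
  simpa [Matrix.algebraMap_matrix_apply, Algebra.algebraMap_eq_smul_one] using h2

/-- **"`d · dim(W) = dim(𝒱)`"**. [cite: DolgachevZarhin2024, §2.3 proof of Theorem 2.21, Step 3] -/
theorem finrank_eq_mul [FiniteDimensional k V] [Module.Finite k W] (e : V ≃ₗ[A] (Fin d → W)) :
    finrank k V = d * finrank k W := by
  rw [(e.restrictScalars k).finrank_eq, Module.finrank_pi_fintype]
  simp

/-- `F = k`, bundled: `k → End_A(W)` is a bijection when every `A`-endomorphism is a scalar (`W ≠ 0`).
[cite: DolgachevZarhin2024, §2.3 proof of Theorem 2.21, Step 3] -/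
theorem bijective_ofId_end [Nontrivial W]
    (hE : ∀ f : Module.End A W, ∃ c : k, f = c • (1 : Module.End A W)) :
    Function.Bijective (Algebra.ofId k (Module.End A W)) := by
  refine ⟨(Algebra.ofId k _).toRingHom.injective, fun f ↦ ?_⟩
  obtain ⟨c, rfl⟩ := hE f
  exact ⟨c, by simp [Algebra.ofId_apply, Algebra.algebraMap_eq_smul_one]⟩

/-- **"This implies that `End_R(𝒱) ≅ Mat_d(𝔽_ℓ)`"**: with `V ≅ W^d` and `End_A(W) = k`,
`End_A(V) ≃ₐ[k] Mat_d(k)`. [cite: DolgachevZarhin2024, §2.3 proof of Theorem 2.21, Step 3] -/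
noncomputable def endAlgEquivMatrixField [Nontrivial W] (e : V ≃ₗ[A] (Fin d → W))
    (hE : ∀ f : Module.End A W, ∃ c : k, f = c • (1 : Module.End A W)) :
    Module.End A V ≃ₐ[k] Matrix (Fin d) (Fin d) k :=
  (endAlgEquivMatrix e).trans (AlgEquiv.ofBijective _ (bijective_ofId_end hE)).symm.mapMatrix

/-- The action homomorphism `A → End_k(W)`, `r ↦ (w ↦ r w)` (Mathlib `Algebra.lsmul`).
[cite: DolgachevZarhin2024, §2.3 proof of Theorem 2.21, Step 3] -/
noncomputable def toEndScalar (k A W : Type*) [Field k] [Ring A] [Algebra k A] [AddCommGroup W]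
    [Module k W] [Module A W] [IsScalarTower k A W] : A →ₐ[k] Module.End k W :=
  Algebra.lsmul k k W

/-- Unfolding: `toEndScalar r w = r • w`. [cite: DolgachevZarhin2024, §2.3 proof of Theorem 2.21, Step 3] -/
@[simp] theorem toEndScalar_apply (r : A) (w : W) : toEndScalar k A W r w = r • w := rfl

omit [Module k V] [IsScalarTower k A V] in
/-- `A` acts faithfully on `W` when it acts faithfully on `V ≅ W^d`, `d ≥ 1` ("Clearly, `𝒱` is a faithful
`R`-module"). [cite: DolgachevZarhin2024, §2.3 proof of Theorem 2.21, Step 3] -/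
theorem toEndScalar_injective [FaithfulSMul A V] [NeZero d] (e : V ≃ₗ[A] (Fin d → W)) :
    Function.Injective (toEndScalar k A W) := by
  intro r r' h
  have key : ∀ w : W, r • w = r' • w := fun w ↦ by
    simpa [toEndScalar_apply] using congrArg (fun φ : Module.End k W ↦ φ w) h
  refine FaithfulSMul.eq_of_smul_eq_smul (α := V) fun v ↦ e.injective ?_
  rw [map_smul, map_smul]
  ext i
  exact key _

/-- **"It follows from the Jacobson density theorem … that `R ≅ Mat_m(𝔽_ℓ)`"** (surjectivity): if `W` is
a simple `A`-module with `End_A(W) = k`, every `k`-linear endomorphism of `W` is the action of some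
`r ∈ A` (Mathlib `Module.Finite.toModuleEnd_moduleEnd_surjective`).
[cite: DolgachevZarhin2024, §2.3 proof of Theorem 2.21, Step 3] [cite: BourbakiAlgebreVIII2012, §5] -/
theorem toEndScalar_surjective [IsSimpleModule A W] [Module.Finite k W]
    (hE : ∀ f : Module.End A W, ∃ c : k, f = c • (1 : Module.End A W)) :
    Function.Surjective (toEndScalar k A W) := by
  haveI : Module.Finite (Module.End A W) W := Module.Finite.of_restrictScalars_finite k _ W
  intro g
  let g' : Module.End (Module.End A W) W :=
    { toFun := g
      map_add' := map_add g
      map_smul' := fun f w ↦ by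
        obtain ⟨c, rfl⟩ := hE f
        change g ((c • (1 : Module.End A W)) w) = (c • (1 : Module.End A W)) (g w)
        simp }
  obtain ⟨r, hr⟩ := Module.Finite.toModuleEnd_moduleEnd_surjective (R := A) (M := W) g'
  refine ⟨r, LinearMap.ext fun w ↦ ?_⟩
  have := congrArg (fun φ : Module.End (Module.End A W) W ↦ φ w) hr
  simp only [Module.toModuleEnd_apply, g', LinearMap.coe_mk, AddHom.coe_mk] at this
  exact this

/-- **"`R ≅ Mat_m(𝔽_ℓ)` with `dm = n − 1`"**: for `A` acting faithfully on `V ≅ W^d` (`d ≥ 1`), `W`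
simple with `End_A(W) = k` and `m = dim_k W`, `A ≃ₐ[k] Mat_m(k)` (density, then a `k`-basis of `W`).
[cite: DolgachevZarhin2024, §2.3 proof of Theorem 2.21, Step 3] -/
noncomputable def algEquivMatrixField [FaithfulSMul A V] [NeZero d] [IsSimpleModule A W]
    [Module.Finite k W] (e : V ≃ₗ[A] (Fin d → W))
    (hE : ∀ f : Module.End A W, ∃ c : k, f = c • (1 : Module.End A W)) :
    A ≃ₐ[k] Matrix (Fin (finrank k W)) (Fin (finrank k W)) k :=
  (AlgEquiv.ofBijective (toEndScalar k A W)
      ⟨toEndScalar_injective (k := k) e, toEndScalar_surjective hE⟩).trans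
    (LinearMap.toMatrixAlgEquiv (Module.finBasis k W))

end Structure

/-! ## §4 The centre step: `Z(End_R(𝒱))` is a field of dimension `≤ dim 𝒱`, hence fixed by `G` -/

section Center

variable {k : Type*} [CommRing k] {A : Type*} [Ring A] [Algebra k A]

/-- An algebra automorphism maps the centre into the centre ("`F` is the center of `Mat_d(F)`, it is
stable under the action of `𝔄_n`"). [cite: DolgachevZarhin2024, §2.3 proof of Theorem 2.21, Step 3] -/
theorem algEquiv_map_mem_center (φ : A ≃ₐ[k] A) {z : A} (hz : z ∈ Subalgebra.center k A) :
    φ z ∈ Subalgebra.center k A := by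
  rw [Subalgebra.mem_center_iff] at hz ⊢
  intro b
  obtain ⟨a, rfl⟩ := φ.surjective b
  rw [← map_mul, ← map_mul, hz]

/-- The restriction of an algebra automorphism to the centre ("we get a homomorphism `𝔄_n → Aut(F)`").
[cite: DolgachevZarhin2024, §2.3 proof of Theorem 2.21, Step 3] -/
def centerCongr (φ : A ≃ₐ[k] A) : Subalgebra.center k A ≃ₐ[k] Subalgebra.center k A where
  toFun z := ⟨φ z, algEquiv_map_mem_center φ z.2⟩
  invFun z := ⟨φ.symm z, algEquiv_map_mem_center φ.symm z.2⟩
  left_inv z := Subtype.ext (φ.symm_apply_apply z)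
  right_inv z := Subtype.ext (φ.apply_symm_apply z)
  map_mul' _ _ := Subtype.ext (map_mul φ _ _)
  map_add' _ _ := Subtype.ext (map_add φ _ _)
  commutes' c := Subtype.ext (φ.commutes c)

/-- Unfolding of `centerCongr`. [cite: DolgachevZarhin2024, §2.3 proof of Theorem 2.21, Step 3] -/
@[simp] theorem coe_centerCongr_apply (φ : A ≃ₐ[k] A) (z : Subalgebra.center k A) :
    ((centerCongr φ z : Subalgebra.center k A) : A) = φ z := rfl

/-- `Aut_k(A) → Aut_k(Z(A))`, restriction to the centre, as a group homomorphism.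
[cite: DolgachevZarhin2024, §2.3 proof of Theorem 2.21, Step 3] -/
def centerCongrHom : (A ≃ₐ[k] A) →* (Subalgebra.center k A ≃ₐ[k] Subalgebra.center k A) where
  toFun := centerCongr
  map_one' := AlgEquiv.ext fun _ ↦ Subtype.ext rfl
  map_mul' _ _ := AlgEquiv.ext fun _ ↦ Subtype.ext rfl

/-- Unfolding of `centerCongrHom`. [cite: DolgachevZarhin2024, §2.3 proof of Theorem 2.21, Step 3] -/
@[simp] theorem centerCongrHom_apply (φ : A ≃ₐ[k] A) : centerCongrHom φ = centerCongr φ := rfl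

/-- The centre of a simple ring is a field (Mathlib `IsSimpleRing.isField_center`, transported from
`Subring.center` to `Subalgebra.center`). [folklore] -/
private theorem isField_center_of_isSimpleRing [IsSimpleRing A] : IsField (Subalgebra.center k A) := by
  have hF := IsSimpleRing.isField_center A
  refine ⟨?_, fun a b ↦ ?_, fun {a} ha ↦ ?_⟩
  · obtain ⟨x, y, hxy⟩ := hF.exists_pair_ne
    refine ⟨⟨x.1, Subalgebra.mem_center_iff.2 (Subring.mem_center_iff.1 x.2)⟩,
      ⟨y.1, Subalgebra.mem_center_iff.2 (Subring.mem_center_iff.1 y.2)⟩, fun h ↦ hxy (Subtype.ext ?_)⟩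
    exact congrArg Subtype.val h
  · exact Subtype.ext ((Subalgebra.mem_center_iff.1 a.2) b).symm
  · have ha' : (⟨a.1, Subring.mem_center_iff.2 (Subalgebra.mem_center_iff.1 a.2)⟩ :
        Subring.center A) ≠ 0 :=
      fun h ↦ ha (Subtype.ext (congrArg Subtype.val h))
    obtain ⟨b, hb⟩ := hF.mul_inv_cancel ha'
    exact ⟨⟨b.1, Subalgebra.mem_center_iff.2 (Subring.mem_center_iff.1 b.2)⟩,
      Subtype.ext (congrArg Subtype.val hb)⟩

end Center

section CenterBound

variable {k : Type*} [Field k] {A : Type*} [Ring A] [Algebra k A]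
  {V : Type*} [AddCommGroup V] [Module k V] [Module A V] [IsScalarTower k A V]

/-- `End_A(V)` is finite-dimensional over `k` when `V` is (it embeds in `End_k(V)`). [folklore] -/
private theorem finite_end_of_finiteDimensional [FiniteDimensional k V] : Module.Finite k (Module.End A V) :=
  Module.Finite.of_injective
    ((LinearMap.restrictScalarsₗ k A V V k) : Module.End A V →ₗ[k] Module.End k V)
    (LinearMap.restrictScalars_injective k)

/-- **`[Z : k] ≤ dim_k V`** for the centre `Z` of `End_A(V)` when `Z` is a field and `V ≠ 0`: `z ↦ z(v₀)`,
`v₀ ≠ 0`, is an injective `k`-linear map (a non-zero `z` is invertible in `Z`). This is the input replacing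
the print's "`Aut(F) = Gal(F/𝔽_ℓ)` is abelian" (see the module docstring, §4).
[cite: DolgachevZarhin2024, §2.3 proof of Theorem 2.21, Step 3] -/
theorem finrank_center_end_le [FiniteDimensional k V] [Nontrivial V]
    (hF : IsField (Subalgebra.center k (Module.End A V))) :
    finrank k (Subalgebra.center k (Module.End A V)) ≤ finrank k V := by
  haveI := finite_end_of_finiteDimensional (k := k) (A := A) (V := V)
  obtain ⟨v₀, hv₀⟩ := exists_ne (0 : V)
  let φ : Subalgebra.center k (Module.End A V) →ₗ[k] V :=
    { toFun := fun z ↦ (z : Module.End A V) v₀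
      map_add' := fun z w ↦ rfl
      map_smul' := fun c z ↦ rfl }
  refine LinearMap.finrank_le_finrank_of_injective (f := φ) ?_
  rw [← LinearMap.ker_eq_bot, LinearMap.ker_eq_bot']
  intro z hz
  by_contra hne
  obtain ⟨w, hw⟩ := hF.mul_inv_cancel hne
  apply hv₀
  have h1 : ((w * z : Subalgebra.center k (Module.End A V)) : Module.End A V) v₀ = v₀ := by
    rw [mul_comm, hw]; rfl
  rw [← h1]
  change (w : Module.End A V) ((z : Module.End A V) v₀) = 0
  rw [show (z : Module.End A V) v₀ = 0 from hz, map_zero]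

end CenterBound

/-! ## §5 Counting: Dedekind's bound, simple groups, `𝐒_r`, and `#Aut_k(Mat_c(k)) ≤ #GL_c(k)` -/

section Count

variable {k : Type*} [Field k]

/-- **`#Aut_k(Z) ≤ [Z : k]`** for a field `Z` finite-dimensional over `k` (Dedekind's independence of
automorphisms; Mathlib `AlgEquiv.card_le`), stated for a commutative `k`-algebra that `IsField`.
[folklore] -/
private theorem natCard_algEquiv_le_finrank {Z : Type*} [CommRing Z] [Algebra k Z] (hZ : IsField Z)
    [FiniteDimensional k Z] : Nat.card (Z ≃ₐ[k] Z) ≤ finrank k Z := by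
  letI : Field Z := hZ.toField
  rw [Nat.card_eq_fintype_card]
  exact AlgEquiv.card_le

/-- Transport of `#Aut_k` along a `k`-algebra isomorphism (`AlgEquiv.autCongr`). [folklore] -/
private theorem natCard_algEquiv_congr {A B : Type*} [Semiring A] [Semiring B] [Algebra k A] [Algebra k B]
    (ψ : A ≃ₐ[k] B) : Nat.card (A ≃ₐ[k] A) = Nat.card (B ≃ₐ[k] B) :=
  Nat.card_congr ψ.autCongr.toEquiv

end Count

section Inner

variable {k : Type*} [CommSemiring k] {A : Type*} [Semiring A] [Algebra k A]

/-- The inner automorphism `x ↦ u x u⁻¹` of a unit `u` ("`Aut(Mat_d(F)) = (Mat_d(F))^*/F^*`": every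
automorphism considered in the print is of this form). [cite: DolgachevZarhin2024, §2.3 proof of Theorem 2.21, Step 3] -/
def innerAlgEquiv (u : Aˣ) : A ≃ₐ[k] A where
  toFun x := u * x * ↑u⁻¹
  invFun x := ↑u⁻¹ * x * u
  left_inv x := by simp [← mul_assoc]
  right_inv x := by simp [← mul_assoc]
  map_mul' x y := by
    simp only [mul_assoc]
    rw [← mul_assoc (↑u⁻¹ : A) (u : A), Units.inv_mul, one_mul]
  map_add' x y := by simp [mul_add, add_mul]
  commutes' c := by
    rw [← Algebra.commutes, mul_assoc, Units.mul_inv, mul_one]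

/-- Unfolding of `innerAlgEquiv`. [cite: DolgachevZarhin2024, §2.3 proof of Theorem 2.21, Step 3] -/
@[simp] theorem innerAlgEquiv_apply (u : Aˣ) (x : A) : innerAlgEquiv (k := k) u x = u * x * ↑u⁻¹ := rfl

end Inner

section MatrixAut

variable {k : Type*} [Field k]

/-- **Every `k`-algebra automorphism of `Mat_c(k)` is inner** (Skolem–Noether for matrix algebras; the
tree's `Literature.LinearAlgebra.Matrix.exists_algHom_apply_eq_conj`): `GL_c(k) → Aut_k(Mat_c(k))`,
`g ↦ (x ↦ g x g⁻¹)`, is onto ("`Aut(End_R(𝒱)) = (End_R(𝒱))^*/𝔽_ℓ^* ≅ GL(d, 𝔽_ℓ)/𝔽_ℓ^*`").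
[cite: DolgachevZarhin2024, §2.3 proof of Theorem 2.21, Step 3] -/
theorem innerAlgEquiv_surjective_matrix (c : ℕ) :
    Function.Surjective
      (fun g : GL (Fin c) k ↦ innerAlgEquiv (k := k) (A := Matrix (Fin c) (Fin c) k) g) := by
  intro φ
  obtain ⟨g, hg⟩ := Literature.LinearAlgebra.Matrix.exists_algHom_apply_eq_conj
    (φ : Matrix (Fin c) (Fin c) k →ₐ[k] Matrix (Fin c) (Fin c) k)
  refine ⟨g, AlgEquiv.ext fun x ↦ ?_⟩
  have hx : x.map (algebraMap k k) = x := by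
    ext i j; rfl
  have := hg x
  rw [hx] at this
  dsimp only
  rw [innerAlgEquiv_apply]
  exact this.symm

/-- **`#Aut_{k-alg}(Mat_c(k)) ≤ #GL_c(k)`** for a finite field `k` — the order bound behind "the order
of `PGL(c, 𝔽_ℓ)` is strictly less than `ℓ^{c²}/(ℓ−1)`" (we keep `#GL_c(k) = ∏_{i<c}(q^c − q^i)`,
Mathlib `Matrix.card_GL_field`, as the bound; see the module docstring, §5).
[cite: DolgachevZarhin2024, §2.3 proof of Theorem 2.21, Step 4 (ii)] -/
theorem natCard_algEquiv_matrix_le [Finite k] (c : ℕ) :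
    Nat.card (Matrix (Fin c) (Fin c) k ≃ₐ[k] Matrix (Fin c) (Fin c) k) ≤ Nat.card (GL (Fin c) k) := by
  haveI : Finite (Matrix (Fin c) (Fin c) k ≃ₐ[k] Matrix (Fin c) (Fin c) k) :=
    Finite.of_injective (fun φ ↦ (φ : Matrix (Fin c) (Fin c) k → Matrix (Fin c) (Fin c) k))
      DFunLike.coe_injective
  exact Nat.card_le_card_of_surjective _ (innerAlgEquiv_surjective_matrix c)

/-- `Aut_{k-alg}(Mat_c(k))` is finite for a finite field `k`. [folklore] -/
private theorem finite_algEquiv_matrix [Finite k] (c : ℕ) :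
    Finite (Matrix (Fin c) (Fin c) k ≃ₐ[k] Matrix (Fin c) (Fin c) k) :=
  Finite.of_injective (fun φ ↦ (φ : Matrix (Fin c) (Fin c) k → Matrix (Fin c) (Fin c) k))
    DFunLike.coe_injective

end MatrixAut

section SimpleGroup

variable {G : Type*} [Group G]

/-- **"Since the order of `𝔄_n` is `n!/2`, every homomorphism from `𝔄_n` to `PGL(c, 𝔽_ℓ)` is trivial"** —
the general principle: a homomorphism from a simple group `G` to a finite group of order `< |G|` is trivial
(its kernel is normal, and it cannot be injective). [cite: DolgachevZarhin2024, §2.3 proof of Theorem 2.21, Step 4 (ii)] -/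
theorem monoidHom_eq_one_of_card_lt {H : Type*} [Group H] [Finite H] [IsSimpleGroup G] (f : G →* H)
    (hlt : Nat.card H < Nat.card G) : f = 1 := by
  rcases f.normal_ker.eq_bot_or_eq_top with hbot | htop
  · exfalso
    have hinj : Function.Injective f := (MonoidHom.ker_eq_bot_iff f).1 hbot
    haveI : Finite G := Finite.of_injective f hinj
    exact absurd (Nat.card_le_card_of_injective f hinj) (not_le.2 hlt)
  · ext g
    have : g ∈ f.ker := htop ▸ Subgroup.mem_top g
    simpa using this

/-- **"Since `G` is a simple group, whose order (`= n!/2`) is greater than `(n − 1)! ≥ r! =` order of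
`𝐒_r`, this homomorphism must be trivial"**: if `N! < |G|` then every `G → 𝐒_r`, `r ≤ N`, is trivial — the
hypothesis of Step 2 in the form `NormalSubalgebraClifford` consumes it.
[cite: DolgachevZarhin2024, §2.3 proof of Theorem 2.21, Step 2] -/
theorem perm_hom_eq_one_of_factorial_lt [IsSimpleGroup G] {N : ℕ} (hN : N.factorial < Nat.card G)
    (r : ℕ) (hr : r ≤ N) (f : G →* Equiv.Perm (Fin r)) : f = 1 := by
  refine monoidHom_eq_one_of_card_lt f (lt_of_le_of_lt ?_ hN)
  rw [Nat.card_perm, Nat.card_eq_fintype_card, Fintype.card_fin]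
  exact Nat.factorial_le hr

/-- A homomorphism from a simple group `G` to `Aut_k(Z)`, `Z` a field with `[Z : k] < |G|`, is trivial
(`#Aut_k(Z) ≤ [Z : k]`). [cite: DolgachevZarhin2024, §2.3 proof of Theorem 2.21, Step 3] -/
theorem algEquiv_hom_eq_one_of_finrank_lt {k : Type*} [Field k] {Z : Type*} [CommRing Z] [Algebra k Z]
    (hZ : IsField Z) [FiniteDimensional k Z] [IsSimpleGroup G] (f : G →* (Z ≃ₐ[k] Z))
    (hlt : finrank k Z < Nat.card G) : f = 1 := by
  letI : Field Z := hZ.toField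
  haveI : Finite (Z ≃ₐ[k] Z) := Finite.of_fintype _
  exact monoidHom_eq_one_of_card_lt f
    (lt_of_le_of_lt (by rw [Nat.card_eq_fintype_card]; exact AlgEquiv.card_le) hlt)

end SimpleGroup

/-! ## §6 Assembly: the centre is fixed, `F = k`, and the criterion -/

namespace IsNormalSubalgebra

variable {k : Type*} [Field k] {G : Type*} [Group G] {V : Type*} [AddCommGroup V] [Module k V]
variable {ρ : Representation k G V} {R : Subalgebra k (Module.End k V)}

/-- **The centre step** ("This implies that the center `F` of `End_R(𝒱)` commutes with `𝔄_n`. Since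
`End_G(𝒱) = 𝔽_ℓ` … we have `k = 𝔽_ℓ`"): for a normal `R` with `End_R(V)` a simple ring, `End_G(V) = k·Id`
and `G` a finite simple group with `dim_k V < |G|`, the centre of `End_R(V)` is `k·Id` — it is a field of
dimension `≤ dim_k V`, so `G → Aut_k(Z)` is trivial by the order count, so `Z` commutes with `ρ(G)`.
[cite: DolgachevZarhin2024, §2.3 proof of Theorem 2.21, Step 3] -/
theorem center_end_eq_bot [FiniteDimensional k V] [Nontrivial V] [Finite G] [IsSimpleGroup G]
    (h : IsNormalSubalgebra ρ R)
    (hcomm : Subalgebra.centralizer k (Set.range (ρ : G → Module.End k V)) = ⊥)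
    (hsimple : IsSimpleRing (Module.End R V)) (hlt : finrank k V < Nat.card G) :
    Subalgebra.center k (Module.End R V) = ⊥ := by
  haveI := hsimple
  haveI := finite_end_of_finiteDimensional (k := k) (A := R) (V := V)
  have hF : IsField (Subalgebra.center k (Module.End R V)) := isField_center_of_isSimpleRing
  haveI : FiniteDimensional k (Subalgebra.center k (Module.End R V)) :=
    Module.Finite.of_injective (Subalgebra.center k (Module.End R V)).val.toLinearMap
      Subtype.val_injective
  -- `G → Aut_k(Z)` is trivial by the order count
  have htriv : (centerCongrHom.comp h.conjEndHom : G →* _) = 1 :=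
    algEquiv_hom_eq_one_of_finrank_lt hF _ (lt_of_le_of_lt (finrank_center_end_le hF) hlt)
  refine le_antisymm (fun z hz ↦ ?_) bot_le
  -- `z` is fixed by every `ρ(s) · ρ(s)⁻¹`, hence a scalar
  obtain ⟨c, hc⟩ := h.exists_eq_smul_one_of_forall_conjEnd_eq hcomm (f := z) fun s ↦ by
    have h1 := DFunLike.congr_fun htriv s
    have h2 := AlgEquiv.congr_fun h1 ⟨z, hz⟩
    have h3 := congrArg Subtype.val h2
    simpa using h3
  rw [hc]
  exact Subalgebra.smul_mem _ (Subalgebra.one_mem _) c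

end IsNormalSubalgebra

section Main

variable {k : Type*} [Field k] {G : Type*} [Group G] {V : Type*} [AddCommGroup V] [Module k V]
variable {ρ : Representation k G V}

/-- An irreducible representation lives on a non-zero space. [folklore] -/
private theorem nontrivial_of_isIrreducible' [ρ.IsIrreducible] : Nontrivial V := by
  have hne : (⊥ : Subrepresentation ρ) ≠ ⊤ := bot_ne_top
  have hne' : (⊥ : Submodule k V) ≠ ⊤ := fun e ↦ hne (Subrepresentation.toSubmodule_injective e)
  exact (Submodule.nontrivial_iff k).mp (nontrivial_of_ne _ _ hne')

/-- **The numerical very-simplicity criterion (Dolgachev–Zarhin, proof of Theorem 2.21, Steps 1–4 with the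
order count of Case (ii)).** Let `k` be a finite field, `V` a finite-dimensional irreducible `G`-module with
`End_G(V) = k·Id` (`Subalgebra.centralizer k ρ(G) = ⊥`), and `G` a finite simple group such that
`(dim_k V)! < |G|` and `#GL_c(k) < |G|` for every `c` with `c² ≤ dim_k V`. Then the `G`-module `V` is very
simple. Proof as printed: a normal `R` makes `V ≅ W^d` isotypic (Steps 1–2), the centre of
`End_R(V) ≅ Mat_d(F)` is `k` so `F = k` (Step 3), `End_R(V) ≅ Mat_d(k)`, `R ≅ Mat_m(k)` with `dm = dim V`
(density), and with `c = min(d, m)` the adjoint action `α` or `β` maps `G` to `Aut_k(Mat_c(k))`, a group of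
order `≤ #GL_c(k) < |G|`, hence is trivial — so `R = End(V)` or `R = k·Id` (Step 4).
[cite: DolgachevZarhin2024, §2.3 Theorem 2.21 (proof, Steps 1–4, Case (ii))] -/
theorem isVerySimple_of_card_lt [Finite k] [FiniteDimensional k V] [Finite G] [IsSimpleGroup G]
    [ρ.IsIrreducible]
    (hcomm : Subalgebra.centralizer k (Set.range (ρ : G → Module.End k V)) = ⊥)
    (hfact : (finrank k V).factorial < Nat.card G)
    (hGL : ∀ c : ℕ, c * c ≤ finrank k V → Nat.card (GL (Fin c) k) < Nat.card G) :
    IsVerySimple ρ := by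
  haveI : Nontrivial V := nontrivial_of_isIrreducible' (ρ := ρ)
  refine ⟨inferInstance, fun R hR ↦ ?_⟩
  -- Steps 1–2: `V` is a semisimple isotypic `R`-module
  haveI : IsSemisimpleModule R V := hR.isSemisimpleModule_of_isIrreducible
  have hiso : IsIsotypic R V :=
    hR.isIsotypic_of_forall_perm_hom_eq_one (perm_hom_eq_one_of_factorial_lt hfact)
  haveI : Module.Finite R V := Module.Finite.of_restrictScalars_finite k R V
  obtain ⟨d, hd, S, hS, ⟨e⟩⟩ := hiso.linearEquiv_fun
  haveI : Module.Finite k S :=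
    Module.Finite.of_injective (S.subtype.restrictScalars k) Subtype.val_injective
  haveI : Nontrivial S := IsSimpleModule.nontrivial R S
  -- Step 3: the centre of the simple ring `End_R(V)` is `k`, hence `F = End_R(W) = k`
  have hdimlt : finrank k V < Nat.card G :=
    lt_of_le_of_lt (Nat.self_le_factorial _) hfact
  have hZ : Subalgebra.center k (Module.End R V) = ⊥ :=
    hR.center_end_eq_bot hcomm (isSimpleRing_end (k := k) (W := S) e) hdimlt
  have hE := exists_end_eq_smul_of_center_eq_bot (k := k) (A := R) (W := S) e
    (end_mul_comm (k := k) (A := R) (W := S)) hZ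
  -- `dm = dim V`
  have hdm : finrank k V = d * finrank k S := finrank_eq_mul (k := k) (W := S) e
  -- Step 4: `c = min(d, m)`
  rcases le_total d (finrank k S) with hle | hle
  · -- `c = d`: `α : G → Aut(End_R(V)) ≅ Aut(Mat_d(k))` is trivial, so `R = End(V)`
    right
    have hc : Nat.card (GL (Fin d) k) < Nat.card G :=
      hGL d (by rw [hdm]; exact Nat.mul_le_mul_left d hle)
    let Ψ := endAlgEquivMatrixField (k := k) (W := S) e hE
    haveI := finite_algEquiv_matrix (k := k) d
    haveI : Finite (Module.End R V ≃ₐ[k] Module.End R V) := Finite.of_equiv _ Ψ.autCongr.symm.toEquiv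
    have hcard : Nat.card (Module.End R V ≃ₐ[k] Module.End R V) < Nat.card G := by
      rw [natCard_algEquiv_congr Ψ]
      exact lt_of_le_of_lt (natCard_algEquiv_matrix_le d) hc
    exact hR.eq_top_of_conjEndHom_eq_one hcomm (monoidHom_eq_one_of_card_lt _ hcard)
  · -- `c = m`: `β : G → Aut(R) ≅ Aut(Mat_m(k))` is trivial, so `R = k·Id`
    left
    have hc : Nat.card (GL (Fin (finrank k S)) k) < Nat.card G :=
      hGL _ (by rw [hdm]; exact Nat.mul_le_mul_right _ hle)
    let Φ := algEquivMatrixField (k := k) (W := S) e hE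
    haveI := finite_algEquiv_matrix (k := k) (finrank k S)
    haveI : Finite (R ≃ₐ[k] R) := Finite.of_equiv _ Φ.autCongr.symm.toEquiv
    have hcard : Nat.card (R ≃ₐ[k] R) < Nat.card G := by
      rw [natCard_algEquiv_congr Φ]
      exact lt_of_le_of_lt (natCard_algEquiv_matrix_le _) hc
    exact hR.eq_bot_of_conjSubHom_eq_one hcomm (monoidHom_eq_one_of_card_lt _ hcard)

end Main

end Literature.RepresentationTheory
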